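import Literature.Geometry.GeometricMeasureTheory.ConstantVectorfield
import Literature.Geometry.GeometricMeasureTheory.CurrentsPolar
import Literature.Geometry.GeometricMeasureTheory.IsoperimetricInequality
import Mathlib.Analysis.Convolution
import Mathlib.Analysis.Calculus.BumpFunction.Normed
import Mathlib.Analysis.Calculus.BumpFunction.InnerProduct
import Mathlib.MeasureTheory.Integral.Prod
import HarnessLib

/-!
# Top-dimensional currents with small boundary are close to constants in mass

Support file for the proof of the named fact
`Literature.Geometry.GeometricMeasureTheory.Federer1969_compactness_integralCurrents` along
B. White's structure-theorem-free proof of the closure theorem [White1989]: the analytic input of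
the projection argument [White1989, p. 219: "According to the Poincaré inequality [S, 6.4] …
there exist `β_λ ∈ ℝ` such that `𝐌_U(T'_λ − β_λ[U]) ≤ c 𝐌_U(∂T'_λ) → 0`"; Bandara2006,
Lemma 4.1.12]. We prove the consequence actually used there, for top-dimensional currents on a
`(k+1)`-dimensional inner product space `P`:

* if `S_l` have bounded mass, their boundaries tested on forms supported in an open `U` tend to
  `0`, and `S_l ⇀ β [U]` weakly on `U`, then `S_l → β [U]` in MASS on every `U'` compactly inside
  `U`, uniformly on test functions: `sup {|S_l(g ω) − β ∫ g| : g ∈ 𝒟(U'), |g| ≤ 1} → 0`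
  (**`eventually_forall_abs_apply_sub_const_integral_le`**).

The proof replaces the BV Poincaré inequality by mollification: with the normalised mollifierBump
`k_ε` and `u_l(x) = S_l(k_ε(x − ·) ω)`,
`S_l(g ω) − β ∫ g = S_l((g − k_ε ⋆ g) ω) + ∫ g (u_l − β) dx`; the second term is `o(1)` uniformly
in `|g| ≤ 1` by dominated convergence (`u_l → β` pointwise, `|u_l| ≤ C_ε`), and the first is
bounded by `(k+1) ε |g|_∞ sup {|∂S_l(ψ)| : spt ψ ⊆ U, |ψ| ≤ 1}` — **the commutator estimate**
`abs_apply_sub_apply_conv_le`: `g − k_ε ⋆ g = ∫ k_ε(t) ∫₀¹ Σᵢ ⟪eᵢ,t⟫ D_{eᵢ} g(· − s t) ds dt`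
and `S(D_{eᵢ} h · ω) = ± ∂S(h · (e ∘ i.succAbove)^♭)` for top-degree forms (Fubini against the
polar representation of `S`).

Also: `Covector.eq_apply_smul_frameCovector` (top covectors are multiples of the volume form of
an orthonormal basis), `TestForm.eq_smulCovectorCLM_frameCovector`, the mollifier test functions
`mollifier hε x` (kernel `mollifierBump`) with `apply_conv_smul_eq_integral` (`S((k_ε ⋆ g) ω) = ∫ g(x) S(k_ε(x−·) ω) dx`).

Definitions with bodies (`mollifierBump`, `mollifier`) and theorems; no named facts.

## References

* B. White, *A new proof of the compactness theorem for integral currents*, Comment. Math.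
  Helv. 64 (1989) 207–220, p. 219 [White1989].
* L. Bandara, *The closure theorem for integral currents without the structure theorem*,
  B.Sc. thesis, ANU 2006, Lemma 4.1.12, pp. 38, 43 [Bandara2006].
* L. Simon, *Lectures on Geometric Measure Theory*, ANU 1983, 6.4, 26.28 [Simon1983].
-/

noncomputable section

open scoped Distributions ENNReal NNReal Topology ContDiff RealInnerProductSpace Convolution Pointwise
open MeasureTheory TopologicalSpace Set Filter Metric Function

namespace Literature.Geometry.GeometricMeasureTheory

-- Nested operator-norm instances on (duals of) `E [⋀^Fin m]→L[ℝ] ℝ`, as in `Currents.lean`.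
set_option maxSynthPendingDepth 3

/-! ### Top-degree covectors -/

section TopCovector

variable {P : Type*} [NormedAddCommGroup P] [InnerProductSpace ℝ P] {k : ℕ}

/-- **Top-degree covectors are multiples of the volume form**: for an orthonormal basis `e` of a
`(k+1)`-dimensional space, `φ = φ(e) · e^♭` for every `(k+1)`-covector `φ`.
[cite: Federer1969, 1.7.5] -/
theorem Covector.eq_apply_smul_frameCovector (e : OrthonormalBasis (Fin (k + 1)) ℝ P)
    (φ : Covector P (k + 1)) : φ = φ e • frameCovector e := by
  classical
  have h := sum_frameCovector_smul e φ
  -- the terms indexed by permutations are all equal to `φ(e) • e^♭`, the others vanish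
  set S : Finset (Fin (k + 1) → Fin (k + 1)) :=
    Finset.univ.image fun σ : Equiv.Perm (Fin (k + 1)) => (σ : Fin (k + 1) → Fin (k + 1)) with hS
  have hinjS : Injective fun σ : Equiv.Perm (Fin (k + 1)) => (σ : Fin (k + 1) → Fin (k + 1)) :=
    fun σ σ' h => Equiv.ext (congr_fun h)
  rw [← Finset.sum_subset (Finset.subset_univ S)] at h
  · rw [hS, Finset.sum_image fun σ _ σ' _ h => hinjS h] at h
    have hterm : ∀ σ : Equiv.Perm (Fin (k + 1)),
        φ (fun j => e ((σ : Fin (k + 1) → Fin (k + 1)) j)) •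
          frameCovector (fun j => e ((σ : Fin (k + 1) → Fin (k + 1)) j)) =
          φ e • frameCovector e := fun σ => by
      have h1 : (fun j => e ((σ : Fin (k + 1) → Fin (k + 1)) j)) = (⇑e) ∘ σ := rfl
      have hs : ((Equiv.Perm.sign σ : ℤ) : ℝ) * ((Equiv.Perm.sign σ : ℤ) : ℝ) = 1 := by
        rw [← Int.cast_mul, ← Units.val_mul, Int.units_mul_self, Units.val_one, Int.cast_one]
      rw [h1, Covector.apply_comp_perm, frameCovector_comp_perm, smul_smul, smul_eq_mul,
        mul_comm (((Equiv.Perm.sign σ : ℤ) : ℝ)) (φ e), mul_assoc, hs, mul_one]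
    simp_rw [hterm, Finset.sum_const, Finset.card_univ, Fintype.card_perm, Fintype.card_fin] at h
    have hfac : ((k + 1).factorial : ℝ) ≠ 0 := Nat.cast_ne_zero.2 (Nat.factorial_ne_zero _)
    have h' : ((k + 1).factorial : ℝ) • (φ e • frameCovector e) = ((k + 1).factorial : ℝ) • φ := by
      rw [← h, ← Nat.cast_smul_eq_nsmul ℝ]
    exact (smul_right_injective _ hfac h').symm
  · intro v _ hv
    have hninj : ¬ Injective (fun j => e (v j)) := by
      intro hinj
      have hvinj : Injective v := fun a b hab => hinj (by simp [hab])
      have hvbij : Bijective v := Finite.injective_iff_bijective.1 hvinj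
      exact hv (Finset.mem_image.2 ⟨Equiv.ofBijective v hvbij, Finset.mem_univ _, rfl⟩)
    rw [φ.map_eq_zero_of_not_injective _ hninj, zero_smul]

/-- A top-degree test form is its `e`-component times the volume form:
`φ = (y ↦ φ(y)(e)) • e^♭`. [cite: Federer1969, 1.7.5] -/
theorem TestForm.eq_smulCovectorCLM_frameCovector (e : OrthonormalBasis (Fin (k + 1)) ℝ P)
    (φ : TestForm (⊤ : Opens P) (k + 1)) :
    φ = smulCovectorCLM (frameCovector e)
      (TestFunction.postcompCLM (frameVector (⇑e) : Multivector P (k + 1)) φ) := by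
  ext y v
  rw [smulCovectorCLM_apply, TestFunction.postcompCLM_apply, comp_apply, frameVector_apply]
  conv_lhs => rw [Covector.eq_apply_smul_frameCovector e (φ y)]

/-- **`d(ψ · (e ∘ i.succAbove)^♭) = (-1)ⁱ D_{eᵢ}ψ · e^♭`** in top degree.
[cite: Federer1969, 4.1.6] -/
theorem extDerivCLM_smulCovectorCLM_frameCovector_eq (e : OrthonormalBasis (Fin (k + 1)) ℝ P)
    (i : Fin (k + 1)) (ψ : 𝓓((⊤ : Opens P), ℝ)) (y : P) :
    TestForm.extDerivCLM (smulCovectorCLM (frameCovector fun j => e (i.succAbove j)) ψ) y =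
      ((-1) ^ (i : ℕ) * fderiv ℝ (ψ : P → ℝ) y (e i)) • frameCovector e := by
  rw [Covector.eq_apply_smul_frameCovector e (TestForm.extDerivCLM _ y),
    extDerivCLM_smulCovectorCLM_frameCovector_apply e.orthonormal i ψ y]

end TopCovector

/-! ### Mollifiers and the polar representation in top degree -/

section Mollifier

variable {P : Type*} [NormedAddCommGroup P] [InnerProductSpace ℝ P] [FiniteDimensional ℝ P]
  [MeasurableSpace P] [BorelSpace P] {k : ℕ}

/-- The mollifierBump of radii `ε/2 < ε` at the origin; its normalisation `k_ε = (mollifierBump hε).normed volume`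
is the mollifying kernel (smooth, `≥ 0`, `∫ k_ε = 1`, `spt k_ε = 𝐁(0, ε)`, even).
[cite: Simon1983, 6.4] -/
def mollifierBump {ε : ℝ} (hε : 0 < ε) : ContDiffBump (0 : P) := ⟨ε / 2, ε, half_pos hε, half_lt_self hε⟩

/-- **The mollifier test function** `y ↦ k_ε(x − y)` centred at `x`. [cite: Simon1983, 6.4] -/
def mollifier {ε : ℝ} (hε : 0 < ε) (x : P) : 𝓓((⊤ : Opens P), ℝ) :=
  ⟨fun y => (mollifierBump hε).normed volume (x - y),
    (mollifierBump hε).contDiff_normed.comp (contDiff_const.sub contDiff_id),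
    (mollifierBump hε).hasCompactSupport_normed.comp_homeomorph (Homeomorph.subLeft x),
    by simp⟩

/-- Unfolding `mollifier`. [cite: Simon1983, 6.4] -/
@[simp] theorem mollifier_apply {ε : ℝ} (hε : 0 < ε) (x y : P) :
    mollifier hε x y = (mollifierBump hε).normed volume (x - y) := rfl

/-- The mollifier at `x` is supported in `𝐁(x, ε)`. [cite: Simon1983, 6.4] -/
theorem tsupport_mollifier_subset {ε : ℝ} (hε : 0 < ε) (x : P) :
    tsupport (mollifier hε x : P → ℝ) ⊆ closedBall x ε := by
  refine closure_minimal (fun y hy => ?_) isClosed_closedBall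
  have h : x - y ∈ Function.support ((mollifierBump hε).normed volume) := hy
  rw [ContDiffBump.support_normed_eq] at h
  change x - y ∈ ball (0 : P) ε at h
  rw [mem_ball, dist_zero_right] at h
  rw [mem_closedBall, dist_comm, dist_eq_norm]
  exact h.le


/-- `0 ≤ k_ε(x - y)`. [cite: Simon1983, 6.4] -/
theorem mollifier_nonneg {ε : ℝ} (hε : 0 < ε) (x y : P) : 0 ≤ mollifier hε x y :=
  (mollifierBump hε).nonneg_normed _

/-- A uniform bound for the mollifying kernel. [cite: Simon1983, 6.4] -/
theorem exists_mollifier_le {ε : ℝ} (hε : 0 < ε) : ∃ K : ℝ, 0 ≤ K ∧ ∀ x y : P, mollifier hε x y ≤ K := by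
  obtain ⟨K, hK⟩ :=
    ((mollifierBump (P := P) hε).hasCompactSupport_normed (μ := (volume : Measure P))).exists_bound_of_continuous
    ((mollifierBump hε).continuous_normed (μ := (volume : Measure P)))
  refine ⟨K, (norm_nonneg _).trans (hK 0), fun x y => ?_⟩
  have := hK (x - y)
  rw [Real.norm_eq_abs, abs_of_nonneg ((mollifierBump hε).nonneg_normed _)] at this
  exact this

/-- `∫ k_ε(x − y) dx = 1` for every `y`. [cite: Simon1983, 6.4] -/
theorem integral_mollifier_left {ε : ℝ} (hε : 0 < ε) (y : P) :
    ∫ x, mollifier hε x y ∂volume = 1 := by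
  have h : (fun x : P => mollifier hε x y) = fun x => (mollifierBump hε).normed volume (x + -y) := by
    funext x; simp [sub_eq_add_neg]
  rw [h, integral_add_right_eq_self (μ := (volume : Measure P))
    (fun x => (mollifierBump hε).normed volume x) (-y)]
  exact (mollifierBump hε).integral_normed (μ := (volume : Measure P))

variable (e : OrthonormalBasis (Fin (k + 1)) ℝ P) {S : Current (⊤ : Opens P) (k + 1)}

/-- **The polar representation in top degree**: `S(θ · e^♭) = ∫ θ ⟨e^♭, S⃗⟩ d‖S‖`.
[cite: Federer1969, 4.1.5] -/
theorem apply_smulCovectorCLM_eq_integral (hS : S.IsRepresentable) (hfin : S.mass ≠ ⊤)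
    (θ : 𝓓((⊤ : Opens P), ℝ)) :
    S (smulCovectorCLM (frameCovector e) θ) =
      ∫ y, θ y * hS.polar hfin y (frameCovector e) ∂S.variation := by
  rw [hS.apply_eq_integral_polar hfin]
  refine integral_congr_ae (Eventually.of_forall fun y => ?_)
  simp only [smulCovectorCLM_apply, map_smul, smul_eq_mul]

/-- `|⟨e^♭, S⃗(y)⟩| ≤ ‖S⃗(y)‖`. [cite: Federer1969, 4.1.5] -/
theorem abs_polar_frameCovector_le (hS : S.IsRepresentable) (hfin : S.mass ≠ ⊤) (y : P) :
    |hS.polar hfin y (frameCovector e)| ≤ ‖hS.polar hfin y‖ := by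
  rw [← Real.norm_eq_abs]
  refine ((hS.polar hfin y).le_opNorm _).trans ?_
  have := norm_frameCovector_le_one e.orthonormal
  exact mul_le_of_le_one_right (norm_nonneg _) this

/-- `‖S⃗‖` is `‖S‖`-integrable (it is `1` a.e. and `‖S‖` is finite). [cite: Federer1969, 4.1.5] -/
theorem integrable_norm_polar (hS : S.IsRepresentable) (hfin : S.mass ≠ ⊤) :
    Integrable (fun y => ‖hS.polar hfin y‖) S.variation := by
  haveI := S.isFiniteMeasure_variation hfin
  refine Integrable.mono' (integrable_const (1 : ℝ))
    (hS.stronglyMeasurable_polar hfin).norm.aestronglyMeasurable ?_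
  filter_upwards [hS.norm_polar_ae_eq_one hfin] with y hy
  rw [Real.norm_eq_abs, abs_norm, hy]

/-- `y ↦ ⟨e^♭, S⃗(y)⟩` is strongly measurable. [cite: Federer1969, 4.1.5] -/
theorem stronglyMeasurable_polar_frameCovector (hS : S.IsRepresentable) (hfin : S.mass ≠ ⊤) :
    StronglyMeasurable fun y => hS.polar hfin y (frameCovector e) :=
  (ContinuousLinearMap.apply ℝ ℝ (frameCovector ⇑e)).continuous.comp_stronglyMeasurable
    (hS.stronglyMeasurable_polar hfin)

/-- **Superposition of mollifiers**: for `ψ = k_ε ⋆ g`,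
`S(ψ · e^♭) = ∫ g(x) S(k_ε(x − ·) · e^♭) dx` (Fubini against the polar representation).
[cite: Simon1983, 6.4; Federer1969, 4.1.5] -/
theorem apply_conv_smul_eq_integral (hS : S.IsRepresentable) (hfin : S.mass ≠ ⊤) {ε : ℝ}
    (hε : 0 < ε) (g ψ : 𝓓((⊤ : Opens P), ℝ))
    (hψ : ∀ y, ψ y = ((mollifierBump hε).normed volume ⋆ (g : P → ℝ)) y) :
    S (smulCovectorCLM (frameCovector e) ψ) =
      ∫ x, g x * S (smulCovectorCLM (frameCovector e) (mollifier hε x)) ∂volume := by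
  haveI := S.isFiniteMeasure_variation hfin
  set c : P → ℝ := fun y => hS.polar hfin y (frameCovector e) with hc
  have hcm : StronglyMeasurable c := stronglyMeasurable_polar_frameCovector e hS hfin
  set kf : P → ℝ := (mollifierBump hε).normed volume with hkf
  have hkc : Continuous kf := (mollifierBump hε).continuous_normed
  obtain ⟨K, hK0, hK⟩ := exists_mollifier_le (P := P) hε
  -- the integrand of the double integral
  set F : P → P → ℝ := fun x y => (g x * kf (x - y)) * c y with hF
  have hψ' : ∀ y, ψ y = ∫ x, g x * kf (x - y) ∂volume := by
    intro y
    rw [hψ y, convolution_eq_swap]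
    refine integral_congr_ae (Eventually.of_forall fun x => ?_)
    simp only [ContinuousLinearMap.lsmul_apply, smul_eq_mul, hkf]
    rw [show y - x = -(x - y) by abel, (mollifierBump hε).normed_neg, mul_comm]
  -- integrability on the product
  have hgi : Integrable (fun x => K * |g x|) (volume : Measure P) :=
    ((g.continuous.integrable_of_hasCompactSupport g.hasCompactSupport).abs).const_mul K
  have hint : Integrable (uncurry fun y x => F x y) (S.variation.prod (volume : Measure P)) := by
    have hmeas : AEStronglyMeasurable (uncurry fun y x => F x y) (S.variation.prod volume) := by
      have h1 : Continuous fun p : P × P => g p.2 * kf (p.2 - p.1) :=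
        (g.continuous.comp continuous_snd).mul (hkc.comp (continuous_snd.sub continuous_fst))
      have h2 : StronglyMeasurable fun p : P × P => c p.1 := hcm.comp_measurable measurable_fst
      exact (h1.aestronglyMeasurable.mul h2.aestronglyMeasurable).congr
        (Eventually.of_forall fun p => by simp [hF, uncurry])
    refine Integrable.mono' ((integrable_norm_polar hS hfin).mul_prod hgi) hmeas
      (Eventually.of_forall fun p => ?_)
    simp only [uncurry, hF, norm_mul, Real.norm_eq_abs]
    have h1 : |kf (p.2 - p.1)| ≤ K := by
      rw [abs_of_nonneg ((mollifierBump hε).nonneg_normed _)]; exact hK p.2 p.1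
    have h2 : |c p.1| ≤ ‖hS.polar hfin p.1‖ := abs_polar_frameCovector_le e hS hfin p.1
    calc |g p.2| * |kf (p.2 - p.1)| * |c p.1| ≤ |g p.2| * K * ‖hS.polar hfin p.1‖ := by
          gcongr
      _ = ‖hS.polar hfin p.1‖ * (K * |g p.2|) := by ring
  calc S (smulCovectorCLM (frameCovector e) ψ)
      = ∫ y, ψ y * c y ∂S.variation := apply_smulCovectorCLM_eq_integral e hS hfin ψ
    _ = ∫ y, ∫ x, F x y ∂volume ∂S.variation := by
        refine integral_congr_ae (Eventually.of_forall fun y => ?_)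
        simp only [hψ' y, hF, ← integral_mul_const]
    _ = ∫ x, ∫ y, F x y ∂S.variation ∂volume := integral_integral_swap hint
    _ = ∫ x, g x * S (smulCovectorCLM (frameCovector e) (mollifier hε x)) ∂volume := by
        refine integral_congr_ae (Eventually.of_forall fun x => ?_)
        change ∫ y, F x y ∂S.variation = g x * S (smulCovectorCLM (frameCovector e) (mollifier hε x))
        rw [apply_smulCovectorCLM_eq_integral e hS hfin, ← integral_const_mul]
        refine integral_congr_ae (Eventually.of_forall fun y => ?_)
        simp only [hF, mollifier_apply, hkf, hc]
        ring

end Mollifier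

/-! ### The commutator estimate `|S(g ω) − S((k_ε ⋆ g) ω)| ≤ (k+1) ε δ |g|_∞` -/

section Commutator

variable {P : Type*} [NormedAddCommGroup P] [InnerProductSpace ℝ P] [FiniteDimensional ℝ P]
  [MeasurableSpace P] [BorelSpace P] {k : ℕ}
  (e : OrthonormalBasis (Fin (k + 1)) ℝ P) {S : Current (⊤ : Opens P) (k + 1)}

omit [FiniteDimensional ℝ P] [MeasurableSpace P] [BorelSpace P] in
/-- **FTC along a segment, in an orthonormal frame**:
`g(y) − g(y − t) = ∫₀¹ Σᵢ ⟪eᵢ, t⟫ D_{eᵢ}g(y − s t) ds`. [cite: Simon1983, 6.4] -/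
theorem sub_apply_sub_eq_intervalIntegral (g : 𝓓((⊤ : Opens P), ℝ)) (y t : P) :
    g y - g (y - t) =
      ∫ s in (0 : ℝ)..1, ∑ i, ⟪e i, t⟫ * fderiv ℝ (g : P → ℝ) (y - s • t) (e i) := by
  have hg1 : ContDiff ℝ 1 (g : P → ℝ) := g.contDiff.of_le (by exact_mod_cast le_top)
  have hderiv : ∀ s : ℝ, HasDerivAt (fun s : ℝ => g (y - s • t))
      (fderiv ℝ (g : P → ℝ) (y - s • t) (-t)) s := by
    intro s
    have h1 : HasDerivAt (fun s : ℝ => y - s • t) (-t) s := by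
      simpa using ((hasDerivAt_id s).smul_const t).const_sub y
    exact ((hg1.differentiable one_ne_zero) _).hasFDerivAt.comp_hasDerivAt s h1
  have hcont : Continuous fun s : ℝ => fderiv ℝ (g : P → ℝ) (y - s • t) (-t) :=
    ((hg1.continuous_fderiv one_ne_zero).comp
      (continuous_const.sub (continuous_id.smul continuous_const))).clm_apply continuous_const
  have hftc := intervalIntegral.integral_eq_sub_of_hasDerivAt (fun s _ => hderiv s)
    (hcont.intervalIntegrable 0 1)
  simp only [one_smul, zero_smul, sub_zero] at hftc
  have hexp : ∀ s : ℝ, ∑ i, ⟪e i, t⟫ * fderiv ℝ (g : P → ℝ) (y - s • t) (e i) =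
      -fderiv ℝ (g : P → ℝ) (y - s • t) (-t) := by
    intro s
    rw [map_neg, neg_neg]
    have h := congr_arg (fderiv ℝ (g : P → ℝ) (y - s • t)) (e.sum_repr' t).symm
    rw [map_sum] at h
    simpa only [map_smul, smul_eq_mul] using h.symm
  simp_rw [hexp, intervalIntegral.integral_neg, hftc]
  ring

/-- `g − k_ε ⋆ g` as a superposition of segment integrals:
`(g − k_ε ⋆ g)(y) = ∫ k_ε(t) ∫₀¹ Σᵢ ⟪eᵢ, t⟫ D_{eᵢ}g(y − s t) ds dt`. [cite: Simon1983, 6.4] -/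
theorem sub_conv_eq_integral {ε : ℝ} (hε : 0 < ε) (g ψ : 𝓓((⊤ : Opens P), ℝ))
    (hψ : ∀ y, ψ y = ((mollifierBump hε).normed volume ⋆ (g : P → ℝ)) y) (y : P) :
    g y - ψ y = ∫ t, (mollifierBump hε).normed volume t *
      (∫ s in (0 : ℝ)..1, ∑ i, ⟪e i, t⟫ * fderiv ℝ (g : P → ℝ) (y - s • t) (e i)) ∂volume := by
  set kf : P → ℝ := (mollifierBump hε).normed volume with hkf
  have h1 : ψ y = ∫ t, kf t * g (y - t) ∂volume := by
    rw [hψ y, convolution_def]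
    simp only [ContinuousLinearMap.lsmul_apply, smul_eq_mul, hkf]
  have h2 : g y = ∫ t, kf t * g y ∂volume := by
    rw [integral_mul_const, (mollifierBump hε).integral_normed, one_mul]
  have hi1 : Integrable (fun t => kf t * g y) (volume : Measure P) :=
    (mollifierBump hε).integrable_normed.mul_const _
  have hi2 : Integrable (fun t => kf t * g (y - t)) (volume : Measure P) :=
    (((mollifierBump hε).continuous_normed).mul (g.continuous.comp (continuous_const.sub continuous_id)))
      |>.integrable_of_hasCompactSupport ((mollifierBump hε).hasCompactSupport_normed.mul_right)
  rw [h1, h2, ← integral_sub hi1 hi2]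
  refine integral_congr_ae (Eventually.of_forall fun t => ?_)
  change kf t * g y - kf t * g (y - t) = _
  rw [← mul_sub, sub_apply_sub_eq_intervalIntegral e g y t]

/-- **Top-degree integration by parts against a translate**: for `θ = g(· − τ)`,
`∫ D_{eᵢ}g(y − τ) ⟨e^♭, S⃗⟩ d‖S‖ = (-1)ⁱ ∂S(θ · (e ∘ i.succAbove)^♭)`.
[cite: Federer1969, 4.1.7] -/
theorem integral_fderiv_translate_mul_polar_eq (hS : S.IsRepresentable) (hfin : S.mass ≠ ⊤)
    (g θ : 𝓓((⊤ : Opens P), ℝ)) (τ : P) (hθ : ∀ y, θ y = g (y - τ)) (i : Fin (k + 1)) :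
    ∫ y, fderiv ℝ (g : P → ℝ) (y - τ) (e i) * hS.polar hfin y (frameCovector e) ∂S.variation =
      (-1) ^ (i : ℕ) *
        S.boundary (smulCovectorCLM (frameCovector fun j => e (i.succAbove j)) θ) := by
  rw [Current.boundary_apply, hS.apply_eq_integral_polar hfin, ← integral_const_mul]
  refine integral_congr_ae (Eventually.of_forall fun y => ?_)
  change _ = (-1) ^ (i : ℕ) * hS.polar hfin y (TestForm.extDerivCLM
    (smulCovectorCLM (frameCovector fun j => e (i.succAbove j)) θ) y)
  rw [extDerivCLM_smulCovectorCLM_frameCovector_eq e i θ y, map_smul, smul_eq_mul]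
  have hθ' : (θ : P → ℝ) = fun y => g (y - τ) := funext hθ
  rw [hθ', fderiv_comp_sub]
  obtain h | h := neg_one_pow_eq_or ℝ (i : ℕ) <;> simp [h]

omit [FiniteDimensional ℝ P] [MeasurableSpace P] [BorelSpace P] in
/-- The support of a translate: `spt g(· − τ) ⊆ 𝐁_‖τ‖-neighbourhood of spt g`; with `‖τ‖ ≤ ε`
it lies in the closed `ε`-thickening of `spt g`. [cite: Simon1983, 6.4] -/
theorem tsupport_translate_subset_cthickening (g θ : 𝓓((⊤ : Opens P), ℝ)) (τ : P)
    (hθ : ∀ y, θ y = g (y - τ)) {ε : ℝ} (hτ : ‖τ‖ ≤ ε) :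
    tsupport (θ : P → ℝ) ⊆ cthickening ε (tsupport (g : P → ℝ)) := by
  have hsub : tsupport (θ : P → ℝ) ⊆ (fun y => y - τ) ⁻¹' tsupport (g : P → ℝ) := by
    refine closure_minimal (fun y hy => ?_) ((isClosed_tsupport _).preimage (by fun_prop))
    have : g (y - τ) ≠ 0 := by rwa [← hθ y]
    exact subset_tsupport _ this
  intro y hy
  have h1 : y - τ ∈ tsupport (g : P → ℝ) := hsub hy
  refine mem_cthickening_of_dist_le y (y - τ) ε _ h1 ?_
  rw [dist_eq_norm, sub_sub_cancel]
  exact hτ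

/-- **The commutator estimate.** If `∂S` is `δ`-small on forms supported in `U`
(`|∂S(ψ)| ≤ δ C` whenever `spt ψ ⊆ U`, `|ψ| ≤ C`), then for a test function `g` whose closed
`ε`-neighbourhood lies in `U` and `|g| ≤ B`,
`|S(g · e^♭) − S((k_ε ⋆ g) · e^♭)| ≤ (k+1) ε δ B`. Proof: write `g − k_ε ⋆ g` as the
superposition `∫ k_ε(t) ∫₀¹ Σᵢ ⟪eᵢ,t⟫ D_{eᵢ}g(· − s t)` (`sub_conv_eq_integral`), move `S` inside
by Fubini against the polar representation, and use `S(D_{eᵢ}h · e^♭) = ±∂S(h · (e∘î)^♭)` with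
`|⟪eᵢ, t⟫| ≤ ε` on `spt k_ε`. [cite: White1989, p. 219; Simon1983, 6.4, 26.28] -/
theorem abs_apply_sub_apply_conv_le (hS : S.IsRepresentable) (hfin : S.mass ≠ ⊤) {U : Set P}
    {δ : ℝ} (hδ : ∀ (ψ : TestForm (⊤ : Opens P) k) (C : ℝ), tsupport ⇑ψ ⊆ U →
      (∀ y, ‖ψ y‖ ≤ C) → |S.boundary ψ| ≤ δ * C)
    {ε : ℝ} (hε : 0 < ε) (g ψ : 𝓓((⊤ : Opens P), ℝ))
    (hψ : ∀ y, ψ y = ((mollifierBump hε).normed volume ⋆ (g : P → ℝ)) y)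
    (hgU : cthickening ε (tsupport (g : P → ℝ)) ⊆ U) {B : ℝ} (hB : ∀ y, |g y| ≤ B) :
    |S (smulCovectorCLM (frameCovector e) g) - S (smulCovectorCLM (frameCovector e) ψ)| ≤
      (k + 1) * ε * δ * B := by
  haveI := S.isFiniteMeasure_variation hfin
  have hB0 : 0 ≤ B := (abs_nonneg _).trans (hB 0)
  set c : P → ℝ := fun y => hS.polar hfin y (frameCovector e) with hc
  have hcm : StronglyMeasurable c := stronglyMeasurable_polar_frameCovector e hS hfin
  have hci : Integrable c S.variation :=
    Integrable.mono' (integrable_norm_polar hS hfin) hcm.aestronglyMeasurable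
      (Eventually.of_forall fun y => by
        simpa [Real.norm_eq_abs] using abs_polar_frameCovector_le e hS hfin y)
  set kf : P → ℝ := (mollifierBump hε).normed volume with hkf
  have hkc : Continuous kf := (mollifierBump hε).continuous_normed
  have hk0 : ∀ t, 0 ≤ kf t := fun t => (mollifierBump hε).nonneg_normed _
  have hksupp : ∀ t, kf t ≠ 0 → ‖t‖ < ε := by
    intro t ht
    have : t ∈ Function.support kf := ht
    rw [hkf, ContDiffBump.support_normed_eq] at this
    change t ∈ ball (0 : P) ε at this
    rwa [mem_ball, dist_zero_right] at this
  have hg1 : ContDiff ℝ 1 (g : P → ℝ) := g.contDiff.of_le (by exact_mod_cast le_top)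
  obtain ⟨D, hD⟩ := (g.hasCompactSupport.fderiv (𝕜 := ℝ)).exists_bound_of_continuous
    (hg1.continuous_fderiv one_ne_zero)
  have hD0 : 0 ≤ D := (norm_nonneg _).trans (hD 0)
  have hDi : ∀ w (i : Fin (k + 1)), |fderiv ℝ (g : P → ℝ) w (e i)| ≤ D := fun w i => by
    rw [← Real.norm_eq_abs]
    refine ((fderiv ℝ (g : P → ℝ) w).le_opNorm _).trans ?_
    rw [e.orthonormal.norm_eq_one i, mul_one]
    exact hD w
  have hinn : ∀ t (i : Fin (k + 1)), |⟪e i, t⟫| ≤ ‖t‖ := fun t i =>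
    (abs_real_inner_le_norm _ _).trans (by rw [e.orthonormal.norm_eq_one i, one_mul])
  -- the superposition integrand
  set Φ : P → ℝ → P → ℝ := fun t s y =>
    kf t * ∑ i, ⟪e i, t⟫ * fderiv ℝ (g : P → ℝ) (y - s • t) (e i) with hΦ
  have hΦc : Continuous fun p : P × ℝ × P => Φ p.1 p.2.1 p.2.2 := by
    refine (hkc.comp continuous_fst).mul (continuous_finsetSum _ fun i _ => ?_)
    refine (continuous_const.inner continuous_fst).mul ?_
    exact ((hg1.continuous_fderiv one_ne_zero).comp
      (continuous_snd.snd.sub (continuous_snd.fst.smul continuous_fst))).clm_apply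
      continuous_const
  set M : ℝ := (k + 1) * ε * D with hM
  have hM0 : 0 ≤ M := by positivity
  have hΦbd : ∀ t s y, |Φ t s y| ≤ M * kf t := by
    intro t s y
    by_cases ht : kf t = 0
    · simp [hΦ, ht]
    have htε : ‖t‖ < ε := hksupp t ht
    simp only [hΦ, abs_mul, abs_of_nonneg (hk0 t)]
    rw [mul_comm M (kf t)]
    refine mul_le_mul_of_nonneg_left ?_ (hk0 t)
    calc |∑ i, ⟪e i, t⟫ * fderiv ℝ (g : P → ℝ) (y - s • t) (e i)|
        ≤ ∑ i, |⟪e i, t⟫ * fderiv ℝ (g : P → ℝ) (y - s • t) (e i)| :=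
          Finset.abs_sum_le_sum_abs _ _
      _ ≤ ∑ _i : Fin (k + 1), ε * D := Finset.sum_le_sum fun i _ => by
          rw [abs_mul]
          exact mul_le_mul ((hinn t i).trans htε.le) (hDi _ i) (abs_nonneg _) hε.le
      _ = M := by simp [hM, Finset.sum_const]; ring
  -- the inner integrals are boundary values of translates, hence `δ`-small
  have hinner : ∀ t s, s ∈ Icc (0 : ℝ) 1 →
      |∫ y, Φ t s y * c y ∂S.variation| ≤ ((k + 1) * ε * δ * B) * kf t := by
    intro t s hs
    by_cases ht : kf t = 0
    · have : (fun y => Φ t s y * c y) = fun _ => 0 := by funext y; simp [hΦ, ht]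
      rw [this, integral_zero, abs_zero, ht, mul_zero]
    have htε : ‖t‖ < ε := hksupp t ht
    obtain ⟨θ, hθ⟩ := exists_testFunction_comp_add_smul (Ω₁ := (⊤ : Opens P))
      (Ω₂ := (⊤ : Opens P)) (s • t) one_ne_zero (by simp) g
    have hθ' : ∀ y, θ y = g (y - s • t) := fun y => by rw [hθ y, inv_one, one_smul]
    have hfi : ∀ i : Fin (k + 1),
        Integrable (fun y => fderiv ℝ (g : P → ℝ) (y - s • t) (e i) * c y) S.variation := by
      intro i
      refine hci.bdd_mul (c := D) ?_ (Eventually.of_forall fun y => ?_)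
      · exact (((hg1.continuous_fderiv one_ne_zero).comp (continuous_id.sub continuous_const))
          |>.clm_apply continuous_const).aestronglyMeasurable
      · rw [Real.norm_eq_abs]; exact hDi _ i
    have hsplit : ∫ y, Φ t s y * c y ∂S.variation = kf t * ∑ i, ⟪e i, t⟫ * ((-1) ^ (i : ℕ) *
        S.boundary (smulCovectorCLM (frameCovector fun j => e (i.succAbove j)) θ)) := by
      have hfun : (fun y => Φ t s y * c y) = fun y =>
          kf t * ∑ i, ⟪e i, t⟫ * (fderiv ℝ (g : P → ℝ) (y - s • t) (e i) * c y) := by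
        funext y
        simp only [hΦ, mul_assoc, Finset.sum_mul]
      rw [hfun, integral_const_mul, integral_finsetSum _ (fun i _ => (hfi i).const_mul _)]
      congr 1
      refine Finset.sum_congr rfl fun i _ => ?_
      rw [integral_const_mul, integral_fderiv_translate_mul_polar_eq e hS hfin g θ (s • t) hθ' i]
    rw [hsplit, abs_mul, abs_of_nonneg (hk0 t), mul_comm (((k : ℝ) + 1) * ε * δ * B) (kf t)]
    refine mul_le_mul_of_nonneg_left ?_ (hk0 t)
    have hst : ‖s • t‖ ≤ ε := by
      rw [norm_smul, Real.norm_eq_abs, abs_of_nonneg hs.1]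
      calc s * ‖t‖ ≤ 1 * ‖t‖ := by gcongr; exact hs.2
        _ ≤ ε := by rw [one_mul]; exact htε.le
    have hbdry : ∀ i : Fin (k + 1),
        |S.boundary (smulCovectorCLM (frameCovector fun j => e (i.succAbove j)) θ)| ≤ δ * B := by
      intro i
      refine hδ _ B ?_ fun y => ?_
      · have hco : ⇑(smulCovectorCLM (Ω := (⊤ : Opens P))
            (frameCovector fun j => e (i.succAbove j)) θ) =
            fun x => θ x • frameCovector fun j => e (i.succAbove j) :=
          funext fun x => smulCovectorCLM_apply _ θ x
        rw [hco]
        exact (tsupport_smul_subset_left _ _).trans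
          ((tsupport_translate_subset_cthickening g θ (s • t) hθ' hst).trans hgU)
      · rw [smulCovectorCLM_apply, norm_smul, Real.norm_eq_abs, hθ' y]
        calc |g (y - s • t)| * ‖frameCovector fun j => e (i.succAbove j)‖ ≤ B * 1 :=
              mul_le_mul (hB _) (norm_frameCovector_le_one
                (e.orthonormal.comp _ Fin.succAbove_right_injective)) (norm_nonneg _) hB0
          _ = B := mul_one B
    calc |∑ i, ⟪e i, t⟫ * ((-1) ^ (i : ℕ) *
          S.boundary (smulCovectorCLM (frameCovector fun j => e (i.succAbove j)) θ))|
        ≤ ∑ i, |⟪e i, t⟫ * ((-1) ^ (i : ℕ) *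
          S.boundary (smulCovectorCLM (frameCovector fun j => e (i.succAbove j)) θ))| :=
          Finset.abs_sum_le_sum_abs _ _
      _ ≤ ∑ _i : Fin (k + 1), ε * (δ * B) := Finset.sum_le_sum fun i _ => by
          rw [abs_mul, abs_mul, abs_pow, abs_neg, abs_one, one_pow, one_mul]
          exact mul_le_mul ((hinn t i).trans htε.le) (hbdry i) (abs_nonneg _) hε.le
      _ = (k + 1) * ε * δ * B := by simp [Finset.sum_const]; ring
  -- `S((g − ψ) ω) = ∫ (g − ψ) c d‖S‖ = ∫_y ∫_t G t y`
  have hsub : S (smulCovectorCLM (frameCovector e) g) - S (smulCovectorCLM (frameCovector e) ψ) =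
      S (smulCovectorCLM (frameCovector e) (g - ψ)) := by rw [map_sub, map_sub]
  rw [hsub, apply_smulCovectorCLM_eq_integral e hS hfin]
  have hgy : ∀ y, (g - ψ) y = ∫ t, (∫ s in (0 : ℝ)..1, Φ t s y) ∂volume := by
    intro y
    rw [show (g - ψ) y = g y - ψ y from rfl, sub_conv_eq_integral e hε g ψ hψ y]
    refine integral_congr_ae (Eventually.of_forall fun t => ?_)
    simp only [hΦ, hkf]
    rw [← intervalIntegral.integral_const_mul]
  set G : P → P → ℝ := fun t y => (∫ s in (0 : ℝ)..1, Φ t s y) * c y with hG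
  have hstep1 : ∫ y, (g - ψ) y * c y ∂S.variation = ∫ y, ∫ t, G t y ∂volume ∂S.variation := by
    refine integral_congr_ae (Eventually.of_forall fun y => ?_)
    change (g - ψ) y * c y = ∫ t, G t y ∂volume
    simp only [hgy y, hG, ← integral_mul_const]
  -- integrability for the swap `y ↔ t`
  have hIΦ : Continuous fun q : (P × P) × ℝ => Φ q.1.2 q.2 q.1.1 :=
    hΦc.comp (by fun_prop : Continuous fun q : (P × P) × ℝ => (q.1.2, q.2, q.1.1))
  have hcontI : Continuous fun p : P × P => ∫ s in (0 : ℝ)..1, Φ p.2 s p.1 :=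
    intervalIntegral.continuous_parametric_intervalIntegral_of_continuous'
      (f := fun (p : P × P) (s : ℝ) => Φ p.2 s p.1) hIΦ 0 1
  have hIbd : ∀ t y, |∫ s in (0 : ℝ)..1, Φ t s y| ≤ M * kf t := by
    intro t y
    have h := intervalIntegral.norm_integral_le_of_norm_le_const (a := (0 : ℝ)) (b := 1)
      (C := M * kf t) (f := fun s => Φ t s y)
      (fun s _ => by rw [Real.norm_eq_abs]; exact hΦbd t s y)
    simpa using h
  have hintA : Integrable (uncurry fun y t => G t y) (S.variation.prod (volume : Measure P)) := by
    have hmeas : AEStronglyMeasurable (uncurry fun y t => G t y) (S.variation.prod volume) := by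
      have h2 : StronglyMeasurable fun p : P × P => c p.1 := hcm.comp_measurable measurable_fst
      exact (hcontI.aestronglyMeasurable.mul h2.aestronglyMeasurable).congr
        (Eventually.of_forall fun p => by simp [hG, uncurry])
    refine Integrable.mono'
      ((integrable_norm_polar hS hfin).mul_prod (((mollifierBump hε).integrable_normed).const_mul M))
      hmeas (Eventually.of_forall fun p => ?_)
    simp only [uncurry, hG, norm_mul, Real.norm_eq_abs]
    calc |∫ s in (0 : ℝ)..1, Φ p.2 s p.1| * |c p.1| ≤ (M * kf p.2) * ‖hS.polar hfin p.1‖ :=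
          mul_le_mul (hIbd _ _) (abs_polar_frameCovector_le e hS hfin _) (abs_nonneg _)
            (mul_nonneg hM0 (hk0 _))
      _ = ‖hS.polar hfin p.1‖ * (M * kf p.2) := mul_comm _ _
  rw [hstep1, integral_integral_swap hintA]
  -- the swap `y ↔ s` for each `t`
  have hswapB : ∀ t, ∫ y, G t y ∂S.variation =
      ∫ s in (0 : ℝ)..1, (∫ y, Φ t s y * c y ∂S.variation) := by
    intro t
    simp only [hG, ← intervalIntegral.integral_mul_const]
    simp_rw [intervalIntegral.integral_of_le zero_le_one]
    haveI : IsFiniteMeasure ((volume : Measure ℝ).restrict (Ioc (0 : ℝ) 1)) :=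
      isFiniteMeasure_restrict.2 (by simp)
    have hmeas : AEStronglyMeasurable (uncurry fun y s => Φ t s y * c y)
        (S.variation.prod ((volume : Measure ℝ).restrict (Ioc 0 1))) := by
      have h1 : Continuous fun p : P × ℝ => Φ t p.2 p.1 :=
        hΦc.comp (by fun_prop : Continuous fun p : P × ℝ => (t, p.2, p.1))
      have h2 : StronglyMeasurable fun p : P × ℝ => c p.1 := hcm.comp_measurable measurable_fst
      exact (h1.aestronglyMeasurable.mul h2.aestronglyMeasurable).congr
        (Eventually.of_forall fun p => by simp [uncurry])
    refine integral_integral_swap (Integrable.mono'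
      ((integrable_norm_polar hS hfin).mul_prod (integrable_const (M * kf t))) hmeas
      (Eventually.of_forall fun p => ?_))
    simp only [uncurry, norm_mul, Real.norm_eq_abs]
    calc |Φ t p.2 p.1| * |c p.1| ≤ (M * kf t) * ‖hS.polar hfin p.1‖ :=
          mul_le_mul (hΦbd t p.2 p.1) (abs_polar_frameCovector_le e hS hfin _) (abs_nonneg _)
            (mul_nonneg hM0 (hk0 _))
      _ = ‖hS.polar hfin p.1‖ * (M * kf t) := mul_comm _ _
  have hGbd : ∀ t, |∫ y, G t y ∂S.variation| ≤ ((k + 1) * ε * δ * B) * kf t := by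
    intro t
    rw [hswapB t]
    have h := intervalIntegral.norm_integral_le_of_norm_le_const (a := (0 : ℝ)) (b := 1)
      (C := ((k + 1) * ε * δ * B) * kf t) (f := fun s => ∫ y, Φ t s y * c y ∂S.variation)
      (fun s hs => by
        rw [Real.norm_eq_abs]
        refine hinner t s ?_
        rw [uIoc_of_le zero_le_one] at hs
        exact Ioc_subset_Icc_self hs)
    simpa using h
  calc |∫ t, ∫ y, G t y ∂S.variation ∂volume| ≤ ∫ t, ((k + 1) * ε * δ * B) * kf t ∂volume := by
        rw [← Real.norm_eq_abs]
        refine norm_integral_le_of_norm_le (((mollifierBump hε).integrable_normed).const_mul _)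
          (Eventually.of_forall fun t => ?_)
        rw [Real.norm_eq_abs]
        exact hGbd t
    _ = (k + 1) * ε * δ * B := by
        rw [integral_const_mul]
        change ((k : ℝ) + 1) * ε * δ * B * ∫ t, (mollifierBump hε).normed volume t ∂volume = _
        rw [(mollifierBump hε).integral_normed, mul_one]

end Commutator

/-! ### Mass convergence from weak convergence and small boundaries -/

section Main

variable {P : Type*} [NormedAddCommGroup P] [InnerProductSpace ℝ P] [FiniteDimensional ℝ P]
  [MeasurableSpace P] [BorelSpace P] {k : ℕ}
  (e : OrthonormalBasis (Fin (k + 1)) ℝ P) {S : Current (⊤ : Opens P) (k + 1)}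

/-- `∫ k_ε(x − y) dy = 1` for every `x`. [cite: Simon1983, 6.4] -/
theorem integral_mollifier {ε : ℝ} (hε : 0 < ε) (x : P) :
    ∫ y, mollifier hε x y ∂volume = 1 := by
  have h : (fun y : P => mollifier hε x y) = fun y => (mollifierBump hε).normed volume (x - y) := by
    funext y; simp
  rw [h, integral_sub_left_eq_self (fun y => (mollifierBump hε).normed volume y) volume x]
  exact (mollifierBump hε).integral_normed (μ := (volume : Measure P))

/-- `k_ε ⋆ g` is a test function. [cite: Simon1983, 6.4] -/
theorem exists_testFunction_conv {ε : ℝ} (hε : 0 < ε) (g : 𝓓((⊤ : Opens P), ℝ)) :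
    ∃ ψ : 𝓓((⊤ : Opens P), ℝ), ∀ y, ψ y = ((mollifierBump hε).normed volume ⋆ (g : P → ℝ)) y := by
  refine ⟨⟨(mollifierBump hε).normed volume ⋆ (g : P → ℝ), ?_, ?_, by simp⟩, fun y => rfl⟩
  · exact (mollifierBump hε).hasCompactSupport_normed.contDiff_convolution_left _
      (mollifierBump hε).contDiff_normed (g.continuous.locallyIntegrable)
  · exact (mollifierBump hε).hasCompactSupport_normed.convolution _ g.hasCompactSupport

/-- The mollified current `x ↦ S(k_ε(x − ·) · e^♭)` is continuous. [cite: Simon1983, 6.4] -/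
theorem continuous_apply_mollifier (hS : S.IsRepresentable) (hfin : S.mass ≠ ⊤) {ε : ℝ}
    (hε : 0 < ε) :
    Continuous fun x => S (smulCovectorCLM (frameCovector e) (mollifier hε x)) := by
  haveI := S.isFiniteMeasure_variation hfin
  obtain ⟨K, hK0, hK⟩ := exists_mollifier_le (P := P) hε
  have hcm : StronglyMeasurable fun y => hS.polar hfin y (frameCovector e) :=
    stronglyMeasurable_polar_frameCovector e hS hfin
  have h : (fun x => S (smulCovectorCLM (frameCovector e) (mollifier hε x))) = fun x =>
      ∫ y, mollifier hε x y * hS.polar hfin y (frameCovector e) ∂S.variation :=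
    funext fun x => apply_smulCovectorCLM_eq_integral e hS hfin _
  rw [h]
  refine continuous_of_dominated (bound := fun y => K * ‖hS.polar hfin y‖) (fun x => ?_)
    (fun x => Eventually.of_forall fun y => ?_) ((integrable_norm_polar hS hfin).const_mul K)
    (Eventually.of_forall fun y => ?_)
  · exact ((mollifier hε x).continuous.stronglyMeasurable.mul hcm).aestronglyMeasurable
  · rw [norm_mul, Real.norm_eq_abs, abs_of_nonneg (mollifier_nonneg hε x y), Real.norm_eq_abs]
    exact mul_le_mul (hK x y) (abs_polar_frameCovector_le e hS hfin y) (abs_nonneg _) hK0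
  · simp only [mollifier_apply]
    exact ((mollifierBump hε).continuous_normed.comp (continuous_id.sub continuous_const)).mul
      continuous_const

/-- **Mass convergence from weak convergence and small boundaries** (the consequence of the
Poincaré inequality used in White's projection argument). Let `S_l` be top-dimensional currents
on the `(k+1)`-dimensional space `P` with `𝐌(S_l) ≤ C < ∞`, whose boundaries are `δ_l`-small on
forms supported in `U` with `δ_l → 0`, and which converge weakly on `U` to `β [P]`:
`S_l(φ · e^♭) → β ∫ φ` for test functions `φ` supported in `U`. Then for every bounded measurable
`U'` with `cthickening (2ε) U' ⊆ U` and every `η > 0`, for all large `l`,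
`|S_l(g · e^♭) − β ∫ g| ≤ η` simultaneously for all test functions `g` supported in `U'` with
`|g| ≤ 1`; i.e. `𝐌_{U'}(S_l − β[U]) → 0`.
[cite: White1989, p. 219; Bandara2006, Lemma 4.1.12; Simon1983, 6.4] -/
theorem eventually_forall_abs_apply_sub_const_integral_le (S : ℕ → Current (⊤ : Opens P) (k + 1))
    {C : ℝ≥0∞} (hC : C ≠ ⊤) (hmass : ∀ l, (S l).mass ≤ C) {U : Set P} (δ : ℕ → ℝ)
    (hδ : Tendsto δ atTop (𝓝 0))
    (hbd : ∀ l (ψ : TestForm (⊤ : Opens P) k) (C' : ℝ), tsupport ⇑ψ ⊆ U → (∀ y, ‖ψ y‖ ≤ C') →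
      |(S l).boundary ψ| ≤ δ l * C')
    (β : ℝ) (hweak : ∀ φ : 𝓓((⊤ : Opens P), ℝ), tsupport (φ : P → ℝ) ⊆ U →
      Tendsto (fun l => S l (smulCovectorCLM (frameCovector e) φ)) atTop
        (𝓝 (β * ∫ y, φ y ∂volume)))
    {U' : Set P} (hU'm : MeasurableSet U') (hU'b : Bornology.IsBounded U') {ε : ℝ} (hε : 0 < ε)
    (hU'U : cthickening (2 * ε) U' ⊆ U) {η : ℝ} (hη : 0 < η) :
    ∀ᶠ l in atTop, ∀ g : 𝓓((⊤ : Opens P), ℝ), tsupport (g : P → ℝ) ⊆ U' → (∀ y, |g y| ≤ 1) →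
      |S l (smulCovectorCLM (frameCovector e) g) - β * ∫ y, g y ∂volume| ≤ η := by
  have hfin : ∀ l, (S l).mass ≠ ⊤ := fun l => ne_top_of_le_ne_top hC (hmass l)
  have hS : ∀ l, (S l).IsRepresentable := fun l => (S l).isRepresentable_of_mass_ne_top (hfin l)
  obtain ⟨K, hK0, hK⟩ := exists_mollifier_le (P := P) hε
  -- the mollified currents `u_l(x) = S_l(k_ε(x − ·) e^♭)`
  set u : ℕ → P → ℝ := fun l x => S l (smulCovectorCLM (frameCovector e) (mollifier hε x)) with hu
  have huc : ∀ l, Continuous (u l) := fun l => continuous_apply_mollifier e (hS l) (hfin l) hε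
  -- uniform bound
  set K' : ℝ := max K 1 with hK'
  have hK'0 : 0 < K' := lt_max_of_lt_right one_pos
  have hubd : ∀ l x, |u l x| ≤ K' * C.toReal := by
    intro l x
    refine ((S l).abs_apply_le_mul_toReal_mass (hfin l) hK'0 fun y => ?_).trans
      (mul_le_mul_of_nonneg_left (ENNReal.toReal_mono hC (hmass l)) hK'0.le)
    rw [smulCovectorCLM_apply, norm_smul, Real.norm_eq_abs, abs_of_nonneg (mollifier_nonneg hε x y)]
    calc mollifier hε x y * ‖frameCovector ⇑e‖ ≤ K * 1 :=
          mul_le_mul (hK x y) (norm_frameCovector_le_one e.orthonormal) (norm_nonneg _) hK0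
      _ ≤ K' := by rw [mul_one]; exact le_max_left _ _
  -- pointwise convergence `u_l(x) → β` on `U'`
  have hupt : ∀ x ∈ U', Tendsto (fun l => u l x) atTop (𝓝 β) := by
    intro x hx
    have hsupp : tsupport (mollifier hε x : P → ℝ) ⊆ U := by
      refine (tsupport_mollifier_subset hε x).trans (subset_trans ?_ hU'U)
      intro y hy
      refine mem_cthickening_of_dist_le y x (2 * ε) U' hx ?_
      rw [mem_closedBall] at hy
      linarith
    have h := hweak (mollifier hε x) hsupp
    rwa [integral_mollifier hε x, mul_one] at h
  -- `I_l = ∫_{U'} |u_l − β| → 0` by dominated convergence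
  have hU'fin : volume U' ≠ ⊤ := hU'b.measure_lt_top.ne
  have hI : Tendsto (fun l => ∫ x in U', |u l x - β| ∂volume) atTop (𝓝 0) := by
    have h := tendsto_integral_of_dominated_convergence (μ := (volume : Measure P).restrict U')
      (F := fun l x => |u l x - β|) (f := fun _ => (0 : ℝ)) (fun _ => K' * C.toReal + |β|)
      (fun l => (((huc l).sub continuous_const).abs).aestronglyMeasurable)
      (by
        haveI : IsFiniteMeasure ((volume : Measure P).restrict U') :=
          isFiniteMeasure_restrict.2 hU'fin
        exact integrable_const _)
      (fun l => Eventually.of_forall fun x => by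
        rw [Real.norm_eq_abs, abs_abs]
        exact (abs_sub _ _).trans (by linarith [hubd l x]))
      (by
        filter_upwards [ae_restrict_mem hU'm] with x hx
        have h := ((hupt x hx).sub_const β).abs
        rwa [sub_self, abs_zero] at h)
    simpa using h
  -- choose `l` large
  have h1 : ∀ᶠ l in atTop, (k + 1) * ε * δ l ≤ η / 2 := by
    have : Tendsto (fun l => (k + 1) * ε * δ l) atTop (𝓝 ((k + 1) * ε * 0)) :=
      hδ.const_mul _
    rw [mul_zero] at this
    exact this.eventually (Iic_mem_nhds (half_pos hη))
  have h2 : ∀ᶠ l in atTop, ∫ x in U', |u l x - β| ∂volume ≤ η / 2 :=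
    hI.eventually (Iic_mem_nhds (half_pos hη))
  filter_upwards [h1, h2] with l hl1 hl2 g hgU' hg1
  obtain ⟨ψ, hψ⟩ := exists_testFunction_conv hε g
  -- the commutator term
  have hcomm : |S l (smulCovectorCLM (frameCovector e) g) - S l (smulCovectorCLM (frameCovector e) ψ)|
      ≤ (k + 1) * ε * δ l * 1 := by
    refine abs_apply_sub_apply_conv_le e (hS l) (hfin l) (hbd l) hε g ψ hψ ?_ hg1
    refine (cthickening_subset_of_subset ε hgU').trans ((cthickening_mono ?_ U').trans hU'U)
    linarith
  -- the mollified term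
  have hmoll : S l (smulCovectorCLM (frameCovector e) ψ) - β * ∫ y, g y ∂volume =
      ∫ x, g x * (u l x - β) ∂volume := by
    rw [apply_conv_smul_eq_integral e (hS l) (hfin l) hε g ψ hψ]
    have hi1 : Integrable (fun x => g x * u l x) (volume : Measure P) :=
      (g.continuous.mul (huc l)).integrable_of_hasCompactSupport g.hasCompactSupport.mul_right
    have hi2 : Integrable (fun x => g x * β) (volume : Measure P) :=
      (g.continuous.integrable_of_hasCompactSupport g.hasCompactSupport).mul_const β
    rw [mul_comm β, ← integral_mul_const, ← integral_sub hi1 hi2]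
    refine integral_congr_ae (Eventually.of_forall fun x => ?_)
    simp only [hu]
    ring
  have hmoll' : |S l (smulCovectorCLM (frameCovector e) ψ) - β * ∫ y, g y ∂volume| ≤
      ∫ x in U', |u l x - β| ∂volume := by
    rw [hmoll, ← integral_indicator hU'm, ← Real.norm_eq_abs]
    refine norm_integral_le_of_norm_le ?_ (Eventually.of_forall fun x => ?_)
    · rw [integrable_indicator_iff hU'm]
      refine Measure.integrableOn_of_bounded hU'fin
        (((huc l).sub continuous_const).abs).aestronglyMeasurable (M := K' * C.toReal + |β|)
        (Eventually.of_forall fun x => ?_)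
      rw [Real.norm_eq_abs, abs_abs]
      exact (abs_sub _ _).trans (by linarith [hubd l x])
    · by_cases hx : x ∈ U'
      · rw [indicator_of_mem hx, norm_mul, Real.norm_eq_abs, Real.norm_eq_abs]
        calc |g x| * |u l x - β| ≤ 1 * |u l x - β| :=
              mul_le_mul_of_nonneg_right (hg1 x) (abs_nonneg _)
          _ = |u l x - β| := one_mul _
      · have hgx : g x = 0 := image_eq_zero_of_notMem_tsupport fun h => hx (hgU' h)
        rw [indicator_of_notMem hx, hgx, zero_mul, norm_zero]
  calc |S l (smulCovectorCLM (frameCovector e) g) - β * ∫ y, g y ∂volume|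
      ≤ |S l (smulCovectorCLM (frameCovector e) g) - S l (smulCovectorCLM (frameCovector e) ψ)| +
          |S l (smulCovectorCLM (frameCovector e) ψ) - β * ∫ y, g y ∂volume| := abs_sub_le _ _ _
    _ ≤ η / 2 + η / 2 := add_le_add (by linarith) (hmoll'.trans hl2)
    _ = η := add_halves η

end Main

end Literature.Geometry.GeometricMeasureTheory
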